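import Literature.NumberTheory.EllipticCurves.SzpiroFreyProofs
import Literature.NumberTheory.DiophantineGeometry.MinimalDiscriminantSmulProofs
import Literature.NumberTheory.DiophantineGeometry.TateAlgorithmInvarianceProofs
import HarnessLib

/-!
# The Frey curve: discharge of the `Szpiro` named facts `isSemistableAt_freyCurve`,
`isSemistable_freyCurve_of_mod`, `conductorNorm_freyCurve_of_mod`,
`minimalDiscriminantNorm_freyCurve_of_mod`

Trunk `DiophValNum` / family `abc` (companion proof file of
`Literature.NumberTheory.EllipticCurves.Szpiro`; theorems only, no definitions). Discharges of the
**abc.S11** named facts of `Szpiro` about the Frey curve `freyCurve a b : y² = x (x − a) (x + b)`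
(`a, b` coprime, `ab(a+b) ≠ 0`):

* `Literature.NumberTheory.EllipticCurves.isSemistableAt_freyCurve_holds` — semistable at every odd prime;
* `Literature.NumberTheory.EllipticCurves.isSemistable_freyCurve_of_mod_holds` — under Serre's normalisation `a ≡ −1 (mod 4)`,
  `32 ∣ b`, semistable at every prime;
* `Literature.NumberTheory.EllipticCurves.conductorNorm_freyCurve_of_mod_holds` — then `N = rad (ab(a+b))`;
* `Literature.NumberTheory.EllipticCurves.minimalDiscriminantNorm_freyCurve_of_mod_holds` — and `2⁸ |Δ_min| = |(ab(a+b))²|`.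

Proofs as in Bombieri–Gubler, *Heights in Diophantine Geometry* (2006), Example 12.5.10: the
integral equations (12.17) `freyIntModel a b` and (12.18) `freyIntModel₂ a b` of
`Literature.NumberTheory.EllipticCurves.SzpiroFreyProofs` are minimal (at odd `p`, resp. everywhere
under the normalisation), the reduction types are read off from `v (Δ)`, `v (c₄)`
(`SzpiroLocalDataProofs`), (12.18) is `ℚ`-isomorphic to the Frey curve by `x = 4x'`,
`y = 8y' + 4x'` (`smul_freyCurve_eq_baseChange_freyIntModel₂`), and conductor, minimal
discriminant and reduction type are isomorphism invariants (`conductor_smul` with the discharged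
`ordMinimalDiscriminant_smul_holds`, `kodairaSymbol_smul_holds`; `isSemistableAt_smul_iff_holds`).

Not discharged here: `conductorNorm_freyCurve_dvd` (`N ∣ 2⁸ rad (ab(a+b))` without normalisation),
which needs the bound `f₂ ≤ 8` (Brumer–Kramer, Lockhart–Rosen–Silverman; the named fact
`conductorExponent_le_eight` of `Conductor`).

## References

* E. Bombieri, W. Gubler, *Heights in Diophantine Geometry*, New Math. Monogr. 4, CUP 2006,
  Example 12.5.10, pp. 429–430. [BombieriGubler2006]
* J.-P. Serre, *Sur les représentations modulaires de degré 2 de `Gal(ℚ̄/ℚ)`*, Duke Math. J. 54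
  (1987), §4.1, Prop. 6. [Serre1987]
* G. Frey, *Links between stable elliptic curves and certain Diophantine equations*, Ann. Univ.
  Sarav. Ser. Math. 1 (1986). [Frey1986]
-/

noncomputable section

open UniqueFactorizationMonoid IsDedekindDomain WeierstrassCurve Rat.HeightOneSpectrum

namespace Literature.NumberTheory.EllipticCurves

/-- The change of variables `x = 4x'`, `y = 8y' + 4x'` (`u = 2`, `r = 0`, `s = 1`, `t = 0`) carries
the Frey curve `freyCurve A B` (equation (12.17)) to the equation (12.18) `freyIntModel₂ A B ⊗ ℚ`,
for `4 ∣ B − A − 1`, `16 ∣ AB`. B–G Ex. 12.5.10 (a). [cite: BombieriGubler2006, Ex. 12.5.10 (12.18)] -/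
theorem smul_freyCurve_eq_baseChange_freyIntModel₂ {A B : ℤ} (h4 : 4 ∣ B - A - 1) (h16 : 16 ∣ A * B) :
    (⟨Units.mk0 (2 : ℚ) two_ne_zero, 0, 1, 0⟩ : VariableChange ℚ) • freyCurve A B =
      (freyIntModel₂ A B).baseChange ℚ := by
  obtain ⟨d, hd⟩ := h4
  obtain ⟨e, he⟩ := h16
  have hd' : (B - A - 1) / 4 = d := by rw [hd]; simp
  have he' : A * B / 16 = e := by rw [he]; simp
  have hdq : (d : ℚ) = ((B : ℚ) - A - 1) / 4 := by
    rw [eq_div_iff (by norm_num)]; exact_mod_cast (by linear_combination -hd : d * 4 = B - A - 1)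
  have heq : (e : ℚ) = (A : ℚ) * B / 16 := by
    rw [eq_div_iff (by norm_num)]; exact_mod_cast (by linear_combination -he : e * 16 = A * B)
  ext
  · simp [freyCurve, freyIntModel₂, baseChange, variableChange_a₁]
  · simp [freyCurve, freyIntModel₂, baseChange, variableChange_a₂, hd', hdq]; ring
  · simp [freyCurve, freyIntModel₂, baseChange, variableChange_a₃]
  · simp [freyCurve, freyIntModel₂, baseChange, variableChange_a₄, he', heq]; ring
  · simp [freyCurve, freyIntModel₂, baseChange, variableChange_a₆]


section Discharges

variable (a b : ℤ)

/-- **Discharge of `Literature.NumberTheory.EllipticCurves.isSemistableAt_freyCurve`** (Frey 1986; Oesterlé 1988, §3; Serre 1987,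
§4.1; B–G Ex. 12.5.10: "for `p ≠ 2` … the singular point `(0, 0)` is a node and there is
multiplicative reduction"): for coprime `a, b` with `ab(a+b) ≠ 0` the Frey curve
`y² = x (x − a) (x + b)` is semistable at every odd prime `p`: if `p ∤ ab(a+b)` then `p ∤ Δ`, good
reduction (`hasGoodReductionAt_of_valuation_Δ_eq_one_holds`); if `p ∣ ab(a+b)` then the integral
equation (12.17) is minimal at `p` with `p ∣ Δ`, `p ∤ c₄ = 16 (a² + ab + b²)`, multiplicative
reduction. [cite: BombieriGubler2006, Ex. 12.5.10] -/
theorem isSemistableAt_freyCurve_holds : isSemistableAt_freyCurve a b := by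
  intro hab h v hv
  rw [← baseChange_freyIntModel]
  haveI := isElliptic_freyIntModel h
  set p := natGenerator v with hp
  have hpp : p.Prime := prime_natGenerator v
  have hpint : Prime (p : ℤ) := Nat.prime_iff_prime_int.mp hpp
  by_cases hpm : (p : ℤ) ∣ a * b * (a + b)
  · -- multiplicative reduction
    right
    have hc₄ : ¬ (p : ℤ) ∣ (freyIntModel a b).c₄ := by
      rw [freyIntModel_c₄]
      intro hc
      rcases hpint.dvd_or_dvd hc with hc | hc
      · exact hv (eq_two_of_dvd_sixteen hpp hc)
      · exact not_dvd_sq_add_mul_add_sq hab hpp hpm hc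
    have hmin := isMinimalAt_baseChange_int_of_not_dvd_c₄ (v := v) (hp ▸ hc₄)
    refine (hasMultiplicativeReductionAt_iff_of_isMinimalAt hmin).mpr ⟨?_, ?_⟩
    · rw [baseChange_int_Δ, Literature.NumberTheory.EllipticCurves.Rat.valuation_intCast_lt_one_iff, ← hp, freyIntModel_Δ]
      exact dvd_mul_of_dvd_right (dvd_pow hpm two_ne_zero) _
    · rw [baseChange_int_c₄, Literature.NumberTheory.EllipticCurves.Rat.valuation_intCast_eq_one_iff, ← hp]
      exact hc₄
  · -- good reduction
    left
    refine hasGoodReductionAt_of_valuation_Δ_eq_one_holds v _ (isIntegralAt_baseChange_int v _) ?_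
    rw [baseChange_int_Δ, Literature.NumberTheory.EllipticCurves.Rat.valuation_intCast_eq_one_iff, ← hp, freyIntModel_Δ]
    intro hΔ
    rcases hpint.dvd_or_dvd hΔ with h16 | h2
    · exact hv (eq_two_of_dvd_sixteen hpp h16)
    · exact hpm (hpint.dvd_of_dvd_pow h2)

variable {a b}

/-- Under Serre's normalisation `a ≡ −1 (mod 4)`, `16 ∣ b`, the local data of the Frey curve at any
prime are those of the global minimal equation (12.18) `freyIntModel₂ a b`: here, its semistability
at every `v` (multiplicative reduction at `p ∣ Δ'`, where `p ∤ c₄' = a² + ab + b²`; good reduction at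
`p ∤ Δ'`). B–G Ex. 12.5.10 (a). [cite: BombieriGubler2006, Ex. 12.5.10] -/
theorem isSemistableAt_freyIntModel₂ (hab : IsCoprime a b) (h : a * b * (a + b) ≠ 0)
    (ha : 4 ∣ a + 1) (hb : 16 ∣ b) (v : HeightOneSpectrum ℤ) :
    ((freyIntModel₂ a b).baseChange ℚ).IsSemistableAt v := by
  have h4 : 4 ∣ b - a - 1 := by
    have : b - a - 1 = b - (a + 1) := by ring
    rw [this]; exact dvd_sub (dvd_trans (by norm_num) hb) ha
  have h16 : 16 ∣ a * b := dvd_mul_of_dvd_right hb _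
  haveI := isElliptic_freyIntModel₂ h h4 h16
  set p := natGenerator v with hp
  have hpp : p.Prime := prime_natGenerator v
  by_cases hΔ : (p : ℤ) ∣ (freyIntModel₂ a b).Δ
  · right
    have hpm := dvd_of_dvd_freyIntModel₂_Δ h4 h16 hpp hΔ
    have hc₄ : ¬ (p : ℤ) ∣ (freyIntModel₂ a b).c₄ := by
      rw [freyIntModel₂_c₄ h4 h16]; exact not_dvd_sq_add_mul_add_sq hab hpp hpm
    have hmin := isMinimalAt_freyIntModel₂ hab ha hb v
    refine (hasMultiplicativeReductionAt_iff_of_isMinimalAt hmin).mpr ⟨?_, ?_⟩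
    · rw [baseChange_int_Δ, Literature.NumberTheory.EllipticCurves.Rat.valuation_intCast_lt_one_iff, ← hp]; exact hΔ
    · rw [baseChange_int_c₄, Literature.NumberTheory.EllipticCurves.Rat.valuation_intCast_eq_one_iff, ← hp]; exact hc₄
  · left
    refine hasGoodReductionAt_of_valuation_Δ_eq_one_holds v _ (isIntegralAt_baseChange_int v _) ?_
    rw [baseChange_int_Δ, Literature.NumberTheory.EllipticCurves.Rat.valuation_intCast_eq_one_iff, ← hp]; exact hΔ

/-- **Discharge of `Literature.NumberTheory.EllipticCurves.isSemistable_freyCurve_of_mod`** (Serre, Duke Math. J. 54 (1987), §4.1,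
Prop. 6; Diamond–Kramer 1995; B–G Ex. 12.5.10 (a): with the normalisation the minimal equation at `2`
is (12.18), "`ȳ² + x̄ȳ = x̄³ + d̄ x̄²` … the singular point `(0̄, 0̄)` is a node. Hence we have
multiplicative reduction"): for coprime `a, b` with `ab(a+b) ≠ 0`, `a ≡ −1 (mod 4)`, `32 ∣ b`, the
Frey curve is semistable at every prime. Semistability is an isomorphism invariant
(`isSemistableAt_smul_iff_holds`), and (12.18) is `ℚ`-isomorphic to the Frey curve
(`smul_freyCurve_eq_baseChange_freyIntModel₂`). (`16 ∣ b` suffices.) [cite: BombieriGubler2006, Ex. 12.5.10] -/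
theorem isSemistable_freyCurve_of_mod_holds (a b : ℤ) : isSemistable_freyCurve_of_mod a b := by
  intro hab h ha hb v
  have ha' : 4 ∣ a + 1 := by
    have := (Int.ModEq.dvd ha.symm)
    simpa [sub_neg_eq_add] using this
  have hb' : 16 ∣ b := dvd_trans (by norm_num) hb
  have h4 : 4 ∣ b - a - 1 := by
    have : b - a - 1 = b - (a + 1) := by ring
    rw [this]; exact dvd_sub (dvd_trans (by norm_num) hb') ha'
  have h16 : 16 ∣ a * b := dvd_mul_of_dvd_right hb' _
  haveI := isElliptic_freyCurve h
  rw [← isSemistableAt_smul_iff_holds v (freyCurve a b)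
    (⟨Units.mk0 (2 : ℚ) two_ne_zero, 0, 1, 0⟩ : VariableChange ℚ),
    smul_freyCurve_eq_baseChange_freyIntModel₂ h4 h16]
  exact isSemistableAt_freyIntModel₂ hab h ha' hb' v


/-- With `32 ∣ b` (and `4 ∣ b − a − 1`), every prime of `ab(a+b)` divides the discriminant
`Δ' = (ab/16)² (a+b)²` of (12.18) — at `p = 2` because `ab/16` is then even (B–G Ex. 12.5.10 (a):
"assuming also that `E` has bad reduction at `2`, `Δ ≡ 0 (mod 2)` leads to `b ≡ 0 (mod 32)`", read
backwards). [cite: BombieriGubler2006, Ex. 12.5.10] -/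
theorem dvd_freyIntModel₂_Δ_of_dvd (h4 : 4 ∣ b - a - 1) (hb : 32 ∣ b) {p : ℕ} (hp : p.Prime)
    (hpm : (p : ℤ) ∣ a * b * (a + b)) : (p : ℤ) ∣ (freyIntModel₂ a b).Δ := by
  have hpint : Prime (p : ℤ) := Nat.prime_iff_prime_int.mp hp
  obtain ⟨b', hb'⟩ := hb
  have h16 : 16 ∣ a * b := ⟨a * (2 * b'), by rw [hb']; ring⟩
  rw [freyIntModel₂_Δ h4 h16]
  have he : a * b / 16 = a * (2 * b') := by
    rw [show a * b = 16 * (a * (2 * b')) by rw [hb']; ring]; simp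
  rw [he]
  rcases hpint.dvd_or_dvd hpm with h | h
  · refine dvd_mul_of_dvd_left (dvd_pow ?_ two_ne_zero) _
    rcases hpint.dvd_or_dvd h with h | h
    · exact dvd_mul_of_dvd_left h _
    · -- `p ∣ b = 32 b'`: either `p = 2` (then `p ∣ 2b'`) or `p ∣ b'`
      rw [hb', show (32 : ℤ) * b' = 2 ^ 4 * (2 * b') by ring] at h
      rcases hpint.dvd_or_dvd h with h | h
      · exact dvd_mul_of_dvd_right (dvd_mul_of_dvd_left (hpint.dvd_of_dvd_pow h) _) _
      · exact dvd_mul_of_dvd_right h _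
  · exact dvd_mul_of_dvd_right (dvd_pow h two_ne_zero) _

/-- The conductor of (12.18) under `a ≡ −1 (mod 4)`, `32 ∣ b`: `f_p = 1` exactly at the primes of
`ab(a+b)` (multiplicative reduction), so `N = rad (ab(a+b))`. B–G Ex. 12.5.10 (a):
"`cond (E) = rad (Δ)`". [cite: BombieriGubler2006, Ex. 12.5.10] -/
theorem conductorNorm_freyIntModel₂ (hab : IsCoprime a b) (h : a * b * (a + b) ≠ 0)
    (ha : 4 ∣ a + 1) (hb : 32 ∣ b) :
    ((freyIntModel₂ a b).baseChange ℚ).conductorNorm ℤ = radical (a * b * (a + b)).natAbs := by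
  have hb' : 16 ∣ b := dvd_trans (by norm_num) hb
  have h4 : 4 ∣ b - a - 1 := by
    have : b - a - 1 = b - (a + 1) := by ring
    rw [this]; exact dvd_sub (dvd_trans (by norm_num) hb') ha
  have h16 : 16 ∣ a * b := dvd_mul_of_dvd_right hb' _
  haveI := isElliptic_freyIntModel₂ h h4 h16
  set m := a * b * (a + b) with hm
  have hm0 : m.natAbs ≠ 0 := Int.natAbs_ne_zero.mpr h
  have hN0 : ((freyIntModel₂ a b).baseChange ℚ).conductorNorm ℤ ≠ 0 := (conductorNorm_pos_holds _).ne'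
  refine Nat.eq_of_factorization_eq hN0 radical_ne_zero fun p ↦ ?_
  by_cases hp : p.Prime
  swap
  · simp [Nat.factorization_eq_zero_of_not_prime _ hp]
  obtain ⟨v, hv⟩ := exists_place ⟨p, hp⟩
  simp only at hv
  have hmin := isMinimalAt_freyIntModel₂ hab ha hb' v
  rw [show p = ((⟨p, hp⟩ : Nat.Primes) : ℕ) from rfl, factorization_conductorNorm_primesEquiv_symm,
    show (primesEquiv (R := ℤ)).symm ⟨p, hp⟩ = v from
      (primesEquiv (R := ℤ)).symm_apply_eq.mpr (Subtype.ext hv.symm),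
    DiophantineGeometry.factorization_radical_apply hm0 hp]
  by_cases hpm : (p : ℤ) ∣ m
  · rw [if_pos (Int.natCast_dvd.mp hpm)]
    refine conductorExponent_eq_one_of_dvd_Δ_of_not_dvd_c₄ hmin ?_ ?_
    · rw [hv]; exact dvd_freyIntModel₂_Δ_of_dvd h4 hb hp hpm
    · rw [hv, freyIntModel₂_c₄ h4 h16]; exact not_dvd_sq_add_mul_add_sq hab hp hpm
  · rw [if_neg (mt Int.natCast_dvd.mpr hpm)]
    refine conductorExponent_eq_zero_of_not_dvd_Δ hmin ?_
    rw [hv]; exact fun hΔ ↦ hpm (dvd_of_dvd_freyIntModel₂_Δ h4 h16 hp hΔ)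

/-- **Discharge of `Literature.NumberTheory.EllipticCurves.conductorNorm_freyCurve_of_mod`** (Serre, Duke Math. J. 54 (1987), §4.1,
Prop. 6; Frey 1986; B–G Ex. 12.5.10 (a): "since `E` has multiplicative reduction at all primes
`p ∣ Δ`, we have `cond (E) = rad (Δ)`"): under `a ≡ −1 (mod 4)`, `32 ∣ b` (`a, b` coprime,
`ab(a+b) ≠ 0`) the conductor of the Frey curve is exactly `rad (ab(a+b))`. The conductor is an
isomorphism invariant (`conductor_smul` with the discharged `ordMinimalDiscriminant_smul_holds`,
`kodairaSymbol_smul_holds`), so it may be computed on (12.18) (`conductorNorm_freyIntModel₂`).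
[cite: BombieriGubler2006, Ex. 12.5.10] -/
theorem conductorNorm_freyCurve_of_mod_holds (a b : ℤ) : conductorNorm_freyCurve_of_mod a b := by
  intro hab h ha hb
  have ha' : 4 ∣ a + 1 := by
    have := (Int.ModEq.dvd ha.symm)
    simpa [sub_neg_eq_add] using this
  have hb' : 16 ∣ b := dvd_trans (by norm_num) hb
  have h4 : 4 ∣ b - a - 1 := by
    have : b - a - 1 = b - (a + 1) := by ring
    rw [this]; exact dvd_sub (dvd_trans (by norm_num) hb') ha'
  have h16 : 16 ∣ a * b := dvd_mul_of_dvd_right hb' _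
  haveI := isElliptic_freyCurve h
  have hC := smul_freyCurve_eq_baseChange_freyIntModel₂ h4 h16
  have hinv := conductor_smul ℤ (freyCurve a b) (fun v ↦ ordMinimalDiscriminant_smul_holds v _)
    (fun v ↦ kodairaSymbol_smul_holds _) (⟨Units.mk0 (2 : ℚ) two_ne_zero, 0, 1, 0⟩ : VariableChange ℚ)
  unfold conductorNorm
  rw [← hinv, hC]
  change ((freyIntModel₂ a b).baseChange ℚ).conductorNorm ℤ = _
  rw [conductorNorm_freyIntModel₂ hab h ha' hb, ← Int.natAbs_natCast (radical (a * b * (a + b)).natAbs),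
    Int.radical_natAbs_eq_radical]

/-- **Discharge of `Literature.NumberTheory.EllipticCurves.minimalDiscriminantNorm_freyCurve_of_mod`** (Serre 1987, §4.1, Prop. 6;
Frey 1986; B–G Ex. 12.5.10 (a): `Δ' = 2⁻⁸ (abc)²` for the global minimal equation (12.18)): under
`a ≡ −1 (mod 4)`, `32 ∣ b` (`a, b` coprime, `ab(a+b) ≠ 0`), `2⁸ |Δ_min| = |(ab(a+b))²|`. The minimal
discriminant is an isomorphism invariant (`ordMinimalDiscriminant_smul_holds`) and equals `|Δ|` of
a global minimal equation over `ℤ` (`minimalDiscriminantNorm_eq_natAbs_holds`). (`16 ∣ b`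
suffices.) [cite: BombieriGubler2006, Ex. 12.5.10] -/
theorem minimalDiscriminantNorm_freyCurve_of_mod_holds (a b : ℤ) :
    minimalDiscriminantNorm_freyCurve_of_mod a b := by
  intro hab h ha hb
  have ha' : 4 ∣ a + 1 := by
    have := (Int.ModEq.dvd ha.symm)
    simpa [sub_neg_eq_add] using this
  have hb' : 16 ∣ b := dvd_trans (by norm_num) hb
  have h4 : 4 ∣ b - a - 1 := by
    have : b - a - 1 = b - (a + 1) := by ring
    rw [this]; exact dvd_sub (dvd_trans (by norm_num) hb') ha'
  have h16 : 16 ∣ a * b := dvd_mul_of_dvd_right hb' _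
  haveI := isElliptic_freyIntModel₂ h h4 h16
  have hC := smul_freyCurve_eq_baseChange_freyIntModel₂ h4 h16
  set C : VariableChange ℚ := ⟨Units.mk0 (2 : ℚ) two_ne_zero, 0, 1, 0⟩
  have hinv : (C • freyCurve a b).minimalDiscriminantNorm ℤ = (freyCurve a b).minimalDiscriminantNorm ℤ := by
    simp only [minimalDiscriminantNorm, minimalDiscriminantIdeal, ordMinimalDiscriminant_smul_holds _ _ C]
  rw [← hinv, hC, minimalDiscriminantNorm_eq_natAbs_holds (freyIntModel₂ a b)
    (Δ_ne_zero_of_isElliptic_baseChange_int (freyIntModel₂ a b)) (isMinimalAt_freyIntModel₂ hab ha' hb'),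
    freyIntModel₂_Δ h4 h16]
  obtain ⟨e, he⟩ := h16
  have he' : a * b / 16 = e := by rw [he]; simp
  rw [he', show (a * b * (a + b)) ^ 2 = 2 ^ 8 * (e ^ 2 * (a + b) ^ 2) by rw [he]; ring,
    Int.natAbs_mul]
  simp [Int.natAbs_mul, Int.natAbs_pow]

end Discharges

end Literature.NumberTheory.EllipticCurves
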